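import Literature.AlgebraicGeometry.Resolution.ArithmeticalThreefoldsLocal
import Literature.AlgebraicGeometry.Resolution.ExcellentClosedSubschemes
import Literature.AlgebraicGeometry.Resolution.LocalBlowup
import Mathlib.RingTheory.Localization.Integral
import Mathlib.FieldTheory.Minpoly.Field
import HarnessLib

/-!
# Cossart–Piltant's local theorem inside one field: eliminating the abstract fraction field

Topic: `Literature/AlgebraicGeometry/Resolution`. PROOF side of `CossartPiltant2019Local`
(`ArithmeticalThreefoldsLocal.lean`; Cossart–Piltant 2019, journal Thm. 1.5 = arXiv v1 Thm. 1.4).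
The printed proof is an induction along a sequence of local blowing ups
`(𝒳, x) = (𝒳₀, x₀) ← (𝒳₁, x₁) ← ⋯` along the valuation `μ` (v1 Thm. 1.4: "there exists a
composition of local Hironaka-permissible blowing ups … where `x_i ∈ 𝒳_i` is the center of
`μ`"), in which the base `S` is replaced at each step by the local ring `S' = 𝒪_{𝒮',s'}` of a
blown-up base at the centre of `μ` (v1 Prop. 2.7) — a subring of the SAME fraction field `K`,
inside the SAME field `L = K(x) ∋ x`, carrying the SAME valuation ring `O = 𝒪_μ`
(`ArithmeticalThreefoldsLocalChart.lean` constructs this step, the new base being a quadratic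
transform along `O` inside `L`). To run that induction in Lean every frame must consist of the
same TYPE of data; this file PROVES that the named fact may be restated with all data inside
the one field `L` and without the auxiliary field `K`:

* the base is a subring `R ⊆ L` (regular local, excellent, of Krull dimension three, residue
  characteristic `p`), `h ∈ R[X]` is monic of degree `p` with root `x ∈ L`;
* "`h` irreducible over `K = Frac S`" becomes **(MIN)**: no nonzero `g ∈ R[X]` of degree `< p`
  has `g(x) = 0` (for monic `h` of degree `p` with `h(x) = 0` this says that `h ↦ K[X]` is the
  minimal polynomial of `x`, i.e. is irreducible);
* "`L = K(x)`" becomes **(GEN)**: every `z ∈ L` satisfies `z·s = g(x)` for some `g ∈ R[X]` and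
  `0 ≠ s ∈ R`;
* case (i) "`char K = p`" becomes `char L = p`; in case (ii) `Aut_K(L)` becomes `Aut_R(L)`
  (`L ≃ₐ[R] L`; an automorphism fixing `R` fixes `K = Frac R`), of order `p` and leaving
  `R[x]` stable;
* the valuation ring `O ⊇ R` dominates `R`, and the conclusion is unchanged: a finite `t ⊆ L`
  with `R[x][t] ⊆ O` regular at the centre `𝔪_O ∩ R[x][t]`.

Content:

* `aeval_map_rangeRestrict`, `adjoin_toSubring_eq_adjoin_range` — moving coefficients into the
  image subring `R = im(S → L)` changes neither evaluation at `x` nor the models `S[s] = R[s]`;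
* `algEquiv_apply_algebraMap_of_isFractionRing`, `natCard_algEquiv_eq_of_isFractionRing`,
  `forall_algEquiv_iff_of_isFractionRing` — `Aut_K(L) = Aut_S(L)` for `K = Frac S`;
* `eq_zero_of_natDegree_lt_of_irreducible` — (MIN) from irreducibility over `K`;
  `exists_mul_algebraMap_eq_aeval_of_adjoin_eq_top` — (GEN) from `L = K(x)` by clearing
  denominators (`IsLocalization.integerNormalization`);
* `CossartPiltant2019Local.of_inField` — PROVED: **the in-field statement implies
  `CossartPiltant2019Local`.**

Everything is PROVED; no definitions and no named facts are introduced (the in-field statement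
appears only as the hypothesis of the reduction theorem, as `of_normalForm` in
`ArithmeticalThreefoldsLocalReduction.lean`).

## Sources

* V. Cossart, O. Piltant, J. Algebra 529 (2019) 268–535 = arXiv:1412.0868: Thm. 1.4 and its
  setting (arXiv v1, p. 4), §2.2 and Prop. 2.7 (p. 14). [CossartPiltant2019]
-/

noncomputable section

open IsLocalRing Polynomial

namespace Literature.AlgebraicGeometry.Resolution

universe u

/-! ## Bookkeeping: a ring and its image in a field -/

section Range

variable {S L : Type u} [CommRing S] [Field L] [Algebra S L]

/-- Evaluation at `x ∈ L` is unchanged when the coefficients are moved into the image subring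
`R = im(S → L)`. [folklore] -/
theorem aeval_map_rangeRestrict (g : S[X]) (x : L) :
    aeval x (g.map (algebraMap S L).rangeRestrict) = aeval x g := by
  rw [aeval_def, eval₂_map, aeval_def]
  rfl

/-- `S[s] = R[s]` as subrings of `L`, for `R = im(S → L)` and any `s ⊆ L`. [folklore] -/
theorem adjoin_toSubring_eq_adjoin_range (s : Set L) :
    (Algebra.adjoin S s).toSubring = (Algebra.adjoin (algebraMap S L).range s).toSubring := by
  rw [Algebra.adjoin_eq_ring_closure, Algebra.adjoin_eq_ring_closure]
  congr 1
  ext y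
  simp only [Set.mem_union, Set.mem_range]
  constructor
  · rintro (⟨a, rfl⟩ | hy)
    · exact Or.inl ⟨⟨algebraMap S L a, a, rfl⟩, rfl⟩
    · exact Or.inr hy
  · rintro (⟨⟨b, a, rfl⟩, rfl⟩ | hy)
    · exact Or.inl ⟨a, rfl⟩
    · exact Or.inr hy

end Range

/-! ## Automorphisms over the fraction field are the automorphisms over the ring -/

section Aut

variable {S K L : Type u} [CommRing S] [Field K] [Algebra S K] [IsFractionRing S K]
  [Field L] [Algebra K L] [Algebra S L] [IsScalarTower S K L]

/-- An `S`-algebra automorphism of `L ⊇ K = Frac S` fixes `K`. [folklore] -/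
theorem algEquiv_apply_algebraMap_of_isFractionRing (τ : L ≃ₐ[S] L) (k : K) :
    τ (algebraMap K L k) = algebraMap K L k := by
  obtain ⟨a, b, hb, rfl⟩ := IsFractionRing.div_surjective (A := S) k
  rw [map_div₀, map_div₀, ← IsScalarTower.algebraMap_apply, ← IsScalarTower.algebraMap_apply,
    τ.commutes, τ.commutes]

variable (S K L) in
/-- `|Aut_K(L)| = |Aut_S(L)|` for `K = Frac S`: restriction of scalars `Aut_K(L) → Aut_S(L)` is a
bijection. [folklore] -/
theorem natCard_algEquiv_eq_of_isFractionRing : Nat.card (L ≃ₐ[K] L) = Nat.card (L ≃ₐ[S] L) := by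
  refine Nat.card_eq_of_bijective (fun σ : L ≃ₐ[K] L => σ.restrictScalars S) ⟨?_, ?_⟩
  · exact AlgEquiv.restrictScalars_injective S
  · intro τ
    refine ⟨{ τ.toRingEquiv with commutes' := algEquiv_apply_algebraMap_of_isFractionRing τ }, ?_⟩
    ext y
    rfl

/-- A property of the underlying maps holds for all of `Aut_K(L)` iff for all of `Aut_S(L)`.
[folklore] -/
theorem forall_algEquiv_iff_of_isFractionRing (P : (L → L) → Prop) :
    (∀ σ : L ≃ₐ[K] L, P σ) ↔ ∀ τ : L ≃ₐ[S] L, P τ := by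
  constructor
  · intro H τ
    have := H { τ.toRingEquiv with commutes' := algEquiv_apply_algebraMap_of_isFractionRing τ }
    exact this
  · intro H σ
    exact H (σ.restrictScalars S)

end Aut

/-! ## (MIN) and (GEN) from the hypotheses over `K` -/

section MinGen

variable {S K L : Type u} [CommRing S] [Field K] [Algebra S K] [IsFractionRing S K]
  [Field L] [Algebra K L] [Algebra S L] [IsScalarTower S K L]

/-- **(MIN)**: if `h ∈ S[X]` is monic, irreducible over `K = Frac S`, with root `x ∈ L`, then no
nonzero `g ∈ S[X]` of degree `< deg h` vanishes at `x` (`h ↦ K[X]` is the minimal polynomial of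
`x`). [folklore] -/
theorem eq_zero_of_natDegree_lt_of_irreducible {h : S[X]} (hmon : h.Monic)
    (hirr : Irreducible (h.map (algebraMap S K))) {x : L} (hx : aeval x h = 0) {g : S[X]}
    (hdeg : g.natDegree < h.natDegree) (hg : aeval x g = 0) : g = 0 := by
  have hxK : aeval x (h.map (algebraMap S K)) = 0 := by rwa [aeval_map_algebraMap]
  have hmin : minpoly K x = h.map (algebraMap S K) :=
    (minpoly.eq_of_irreducible_of_monic hirr hxK (hmon.map _)).symm
  have hgK : aeval x (g.map (algebraMap S K)) = 0 := by rwa [aeval_map_algebraMap]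
  have hdvd : minpoly K x ∣ g.map (algebraMap S K) := minpoly.dvd K x hgK
  by_contra hg0
  have hgK0 : g.map (algebraMap S K) ≠ 0 := fun h0 =>
    hg0 ((Polynomial.map_eq_zero_iff (IsFractionRing.injective S K)).mp h0)
  have hle := Polynomial.natDegree_le_of_dvd hdvd hgK0
  rw [hmin, hmon.natDegree_map, natDegree_map_eq_of_injective (IsFractionRing.injective S K)] at hle
  exact absurd hdeg (not_lt.mpr hle)

/-- **(GEN)**: if `L = K(x)`, `K = Frac S`, every `z ∈ L` satisfies `z · s = g(x)` for some
`g ∈ S[X]` and `0 ≠ s ∈ S` (clear the denominators of a polynomial over `K`,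
`IsLocalization.integerNormalization`). [folklore] -/
theorem exists_mul_algebraMap_eq_aeval_of_adjoin_eq_top [IsDomain S] {x : L}
    (hgen : Algebra.adjoin K ({x} : Set L) = ⊤) (z : L) :
    ∃ (g : S[X]) (s : S), s ≠ 0 ∧ z * algebraMap S L s = aeval x g := by
  have hz : z ∈ Algebra.adjoin K ({x} : Set L) := by rw [hgen]; exact Algebra.mem_top
  rw [Algebra.adjoin_singleton_eq_range_aeval] at hz
  obtain ⟨q, hq⟩ := hz
  have hq' : aeval x q = z := hq
  obtain ⟨b, hbM, hb⟩ := IsLocalization.integerNormalization_spec (nonZeroDivisors S) q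
  refine ⟨IsLocalization.integerNormalization (nonZeroDivisors S) q, b,
    nonZeroDivisors.ne_zero hbM, ?_⟩
  have h1 : aeval x (IsLocalization.integerNormalization (nonZeroDivisors S) q) =
      aeval x ((IsLocalization.integerNormalization (nonZeroDivisors S) q).map (algebraMap S K)) := by
    rw [aeval_map_algebraMap]
  rw [h1, hb, ← algebraMap_smul K b q, map_smul, hq', Algebra.smul_def,
    ← IsScalarTower.algebraMap_apply, mul_comm]

end MinGen

/-! ## The in-field form implies the named fact -/

/-- **Cossart–Piltant's local theorem, in-field form ⇒ `CossartPiltant2019Local`.** Suppose that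
for every prime `p`, every field `L`, every subring `R ⊆ L` which is an excellent regular local
ring of Krull dimension `3` with residue field of characteristic `p`, every monic `h ∈ R[X]` of
degree `p` with a root `x ∈ L` such that (MIN) no nonzero `g ∈ R[X]` of degree `< p` has
`g(x) = 0` and (GEN) every `z ∈ L` has `z·s = g(x)` for some `g ∈ R[X]`, `0 ≠ s ∈ R`, in case
(i) `char L = p` and `h = X^p + f_p`, or (ii) `Aut_R(L)` has order `p` and leaves `R[x]` stable,
and every valuation ring `O ⊇ R` of `L` dominating `R`, there is a finite `t ⊆ L` with
`R[x][t] ⊆ O` regular at the centre `𝔪_O ∩ R[x][t]`. Then `CossartPiltant2019Local` holds: for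
data `(S, K, L, h, x, O)` of the named fact take `R = im(S → L) ≅ S` (regularity, excellence,
dimension, residue characteristic and `h` are transported along the isomorphism), (MIN) holds
because `h ↦ K[X]` is the minimal polynomial of `x`, (GEN) because `L = K(x)` and
`K = Frac S`, `char L = char K`, `Aut_K(L) = Aut_R(L)` with `S[x] = R[x]`, and the conclusion
for `R[x][t] = S[x][t]` is the conclusion of the fact. This is the common type of all frames
`(S_i, h_i, x_i)` of the printed induction along the local blowing ups of `μ` (v1 Thm. 1.4,
Prop. 2.7): subrings of one field `L` carrying one valuation ring `O`.
[cite: CossartPiltant2019, Thm. 1.4 and Prop. 2.7 (arXiv v1, pp. 4, 14)] -/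
theorem CossartPiltant2019Local.of_inField
    (H : ∀ (p : ℕ), p.Prime → ∀ (L : Type u) [Field L] (R : Subring L) [IsRegularLocalRing R],
      IsExcellentRing R → ringKrullDim R = 3 → CharP (ResidueField R) p →
      ∀ (h : R[X]) (x : L), h.Monic → h.natDegree = p → aeval x h = 0 →
      (∀ g : R[X], g.natDegree < p → aeval x g = 0 → g = 0) →
      (∀ z : L, ∃ (g : R[X]) (s : R), s ≠ 0 ∧ z * s = aeval x g) →
      ((CharP L p ∧ ∀ i, 0 < i → i < p → h.coeff i = 0) ∨
        (Nat.card (L ≃ₐ[R] L) = p ∧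
          ∀ σ : L ≃ₐ[R] L, ∀ y ∈ Algebra.adjoin R ({x} : Set L),
            σ y ∈ Algebra.adjoin R ({x} : Set L))) →
      ∀ (O : ValuationSubring L), R ≤ O.toSubring →
        (∀ r : R, r ∈ maximalIdeal R → O.valuation (r : L) < 1) →
        ∃ (t : Finset L) (ht : (Algebra.adjoin R (insert x (t : Set L))).toSubring ≤ O.toSubring),
          IsRegularLocalRing (Localization.AtPrime
            (Ideal.comap (Subring.inclusion ht) (maximalIdeal O)))) :
    CossartPiltant2019Local.{u} := by
  intro p hp S _ _ _ hexc hdim hchar K _ _ _ L _ _ _ _ h x hmon hdeg hirr hx hgen hcase O hSO hcen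
  classical
  -- the image subring `R = im(S → L) ≅ S`
  have hinj : Function.Injective (algebraMap S L) := by
    rw [IsScalarTower.algebraMap_eq S K L]
    exact (algebraMap K L).injective.comp (IsFractionRing.injective S K)
  set R : Subring L := (algebraMap S L).range with hRdef
  set f : S →+* R := (algebraMap S L).rangeRestrict with hf
  have hfbij : Function.Bijective f :=
    ⟨fun a b hab => hinj (congrArg Subtype.val hab), RingHom.rangeRestrict_surjective _⟩
  let e : S ≃+* R := RingEquiv.ofBijective f hfbij
  have he : ∀ s : S, ((e s : R) : L) = algebraMap S L s := fun _ => rfl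
  haveI : IsRegularLocalRing R := IsRegularLocalRing.of_ringEquiv e
  have hexcR : IsExcellentRing R := hexc.of_ringEquiv e
  have hdimR : ringKrullDim R = 3 := by rw [← ringKrullDim_eq_of_ringEquiv e, hdim]
  haveI hloc : IsLocalHom e.toRingHom :=
    ⟨fun a ha => by simpa using ha.map e.symm.toRingHom⟩
  have hcharR : CharP (ResidueField R) p :=
    (RingHom.charP_iff_charP (ResidueField.map e.toRingHom) p).mp hchar
  -- the equation over `R`
  set h' : R[X] := h.map f with hh'
  have hmon' : h'.Monic := hmon.map f
  have hdeg' : h'.natDegree = p := by rw [hh', hmon.natDegree_map, hdeg]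
  have haeval : ∀ g : S[X], aeval x (g.map f) = aeval x g := fun g => aeval_map_rangeRestrict g x
  have hx' : aeval x h' = 0 := by rw [hh', haeval, hx]
  -- (MIN)
  have hmin : ∀ g : R[X], g.natDegree < p → aeval x g = 0 → g = 0 := by
    intro g hgdeg hg
    set g₀ : S[X] := g.map e.symm.toRingHom with hg₀
    have hgg₀ : g₀.map f = g := by
      rw [hg₀, Polynomial.map_map]
      ext i
      rw [coeff_map]
      exact congrArg Subtype.val (e.apply_symm_apply (g.coeff i))
    have hg₀x : aeval x g₀ = 0 := by rw [← haeval, hgg₀, hg]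
    have hg₀deg : g₀.natDegree < h.natDegree := by
      have hdd : g₀.natDegree = g.natDegree := by
        rw [← hgg₀, natDegree_map_eq_of_injective hfbij.1]
      rw [hdd, hdeg]
      exact hgdeg
    have := eq_zero_of_natDegree_lt_of_irreducible (K := K) hmon hirr hx hg₀deg hg₀x
    rw [← hgg₀, this, Polynomial.map_zero]
  -- (GEN)
  have hgen' : ∀ z : L, ∃ (g : R[X]) (s : R), s ≠ 0 ∧ z * s = aeval x g := by
    intro z
    obtain ⟨g, s, hs, hz⟩ := exists_mul_algebraMap_eq_aeval_of_adjoin_eq_top (S := S) (K := K) hgen z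
    refine ⟨g.map f, e s, fun h0 => hs (e.injective (by rw [h0, map_zero])), ?_⟩
    rw [haeval, he, hz]
  -- `S[x] = R[x]`
  have hadj : ∀ y : L, y ∈ Algebra.adjoin S ({x} : Set L) ↔ y ∈ Algebra.adjoin R ({x} : Set L) := by
    intro y
    rw [← Subalgebra.mem_toSubring, adjoin_toSubring_eq_adjoin_range, Subalgebra.mem_toSubring]
  -- cases (i)/(ii)
  have hcase' : (CharP L p ∧ ∀ i, 0 < i → i < p → h'.coeff i = 0) ∨
      (Nat.card (L ≃ₐ[R] L) = p ∧ ∀ σ : L ≃ₐ[R] L, ∀ y ∈ Algebra.adjoin R ({x} : Set L),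
        σ y ∈ Algebra.adjoin R ({x} : Set L)) := by
    rcases hcase with ⟨hK, hcoef⟩ | ⟨hcard, hstab⟩
    · refine Or.inl ⟨?_, fun i hi0 hip => ?_⟩
      · haveI := hK
        exact charP_of_injective_ringHom (algebraMap K L).injective p
      · rw [hh', coeff_map, hcoef i hi0 hip, map_zero]
    · right
      -- `Aut_R(L) = Aut_S(L) = Aut_K(L)` (the `R`-algebra structure of `L` is the `S`-one)
      have hRS : ∀ τ : L ≃ₐ[R] L, ∀ s : S, τ (algebraMap S L s) = algebraMap S L s :=
        fun τ s => τ.commutes (e s)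
      have hSR : ∀ τ : L ≃ₐ[S] L, ∀ r : R, τ (r : L) = r := by
        intro τ r
        obtain ⟨s, rfl⟩ := e.surjective r
        exact τ.commutes s
      have hbij : Function.Bijective (fun τ : L ≃ₐ[R] L =>
          ({ τ.toRingEquiv with commutes' := hRS τ } : L ≃ₐ[S] L)) := by
        constructor
        · intro τ₁ τ₂ h12
          ext y
          exact congrArg (fun φ : L ≃ₐ[S] L => φ y) h12
        · intro τ
          exact ⟨{ τ.toRingEquiv with commutes' := hSR τ }, by ext; rfl⟩
      refine ⟨?_, ?_⟩
      · rw [Nat.card_eq_of_bijective _ hbij, ← natCard_algEquiv_eq_of_isFractionRing S K L, hcard]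
      · intro σ y hy
        have hτ := (forall_algEquiv_iff_of_isFractionRing (S := S) (K := K) (L := L)
          (fun φ => ∀ y ∈ Algebra.adjoin S ({x} : Set L), φ y ∈ Algebra.adjoin S ({x} : Set L))).mp
          hstab ({ σ.toRingEquiv with commutes' := hRS σ } : L ≃ₐ[S] L)
        exact (hadj _).mp (hτ y ((hadj y).mpr hy))
  -- the valuation ring
  have hRO : R ≤ O.toSubring := by
    rintro _ ⟨s, rfl⟩
    exact hSO s
  have hcen' : ∀ r : R, r ∈ maximalIdeal R → O.valuation (r : L) < 1 := by
    intro r hr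
    obtain ⟨s, rfl⟩ := e.surjective r
    have hs : s ∈ maximalIdeal S := (map_mem_nonunits_iff e.toRingHom s).mp hr
    exact hcen s hs
  -- apply the in-field statement and transport the conclusion
  obtain ⟨t, ht, hreg⟩ :=
    H p hp L R hexcR hdimR hcharR h' x hmon' hdeg' hx' hmin hgen' hcase' O hRO hcen'
  have e₂ : (Algebra.adjoin S (insert x (t : Set L))).toSubring =
      (Algebra.adjoin R (insert x (t : Set L))).toSubring :=
    adjoin_toSubring_eq_adjoin_range _
  have ht' : (Algebra.adjoin S (insert x (t : Set L))).toSubring ≤ O.toSubring := e₂ ▸ ht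
  exact ⟨t, ht', (isRegularLocalRing_centre_congr e₂ ht' ht).mpr hreg⟩

end Literature.AlgebraicGeometry.Resolution

end
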